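import Summits.Ventures.HodgeRepro2.T5SU11RadialGreenKernel
import Summits.Ventures.HodgeRepro2.T5SU11ResolventCommute
import Summits.Ventures.HodgeRepro2.T5SU11ResolventComposition

/-!
# The improper Green's operator as an integral operator on `(0, ∞)`, and the kernel of the composition
`G_λ G_{λ₂}` as the difference quotient of the kernels

* **`greenSolI_eq_integral_kernel`** — for every source integrable against the basis,
  `G^I g(t) = ∫_{(0,∞)} K(t, s) g(s) sinh 2s ds` with the kernel `K(t, s) = −φ(min(t,s)) χ(max(t,s))` of row 461
  (split `(0, ∞) = (0, t] ∪ (t, ∞)`: on the first piece `K = −φ(s)χ(t)`, on the second `K = −φ(t)χ(s)`);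
* **`sphGreen_eq_integral_kernel_all`** — for a source `f` supported in `[a, b]`, row 451's `G_λ f(t) = ∫_a^b K_λ(t, s)
  f(s) sinh 2s ds` holds for EVERY `t > 0` (row 461 had it for `a ≤ t ≤ b`): `G_λ f = G^I_λ f` (row 492) and the
  integrand vanishes off `(a, b)`;
* **`sphGreen_comp_eq_integral_kernel`** — for `λ ≠ λ₂` the composition `G_λ G_{λ₂} f = G^I_λ(G_{λ₂} f)` is the integral
  operator with kernel **`(K_λ(t, s) − K_{λ₂}(t, s))/(μ − μ₂)`** (the resolvent identity of row 495 read on the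
  kernels — no Fubini is needed), i.e. `K_{λλ₂} = (K_λ − K_{λ₂})/(μ − μ₂)` is the kernel of `(L − μ)⁻¹(L − μ₂)⁻¹`.

Nothing is claimed about (N).

Blind lane: Mathlib + the HodgeRepro2 prefix only; no sorry; axioms ⊆ {propext, Classical.choice,
Quot.sound}.
-/

namespace Summit.Ventures.HodgeRepro2.T5SU11ResolventKernelComposition

open Filter Topology MeasureTheory intervalIntegral
open Set (Ioi Ioc Icc)
open T5SU11Cartan T5SU11SphericalFunction T5SU11SphericalContinuous T5SU11SphericalDecay
  T5SU11SphericalSolutionSpaceAll T5SU11RadialGreen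
  T5SU11RadialGreenKernel T5SU11SphericalGreen T5SU11RadialGreenImproper T5SU11ResolventCommute
  T5SU11ResolventComposition

/-! ### The improper Green's operator as an integral operator -/

/-- **`G^I g(t) = ∫_{(0,∞)} K(t, s) g(s) sinh 2s ds`** for a source integrable against the basis. -/
theorem greenSolI_eq_integral_kernel {φ χ g : ℝ → ℝ}
    (hB : ∀ T, IntegrableOn (fun s => φ s * g s * Real.sinh (2 * s)) (Ioc 0 T))
    (hA : IntegrableOn (fun s => χ s * g s * Real.sinh (2 * s)) (Ioi 0)) {t : ℝ} (ht : 0 < t) :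
    greenSolI φ χ g t = ∫ s in Ioi 0, greenKernel φ χ t s * g s * Real.sinh (2 * s) := by
  have hsplit : Ioc 0 t ∪ Ioi t = Ioi 0 := Set.Ioc_union_Ioi_eq_Ioi ht.le
  have hdisj : Disjoint (Ioc 0 t) (Ioi t) := Set.Ioc_disjoint_Ioi le_rfl
  have h1 : Set.EqOn (fun s => greenKernel φ χ t s * g s * Real.sinh (2 * s))
      (fun s => -χ t * (φ s * g s * Real.sinh (2 * s))) (Ioc 0 t) := by
    intro s hs
    simp only
    rw [greenKernel_of_le φ χ hs.2]
    ring
  have h2 : Set.EqOn (fun s => greenKernel φ χ t s * g s * Real.sinh (2 * s))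
      (fun s => -φ t * (χ s * g s * Real.sinh (2 * s))) (Ioi t) := by
    intro s hs
    simp only
    rw [greenKernel_of_ge φ χ (le_of_lt hs)]
    ring
  have hI1 : IntegrableOn (fun s => greenKernel φ χ t s * g s * Real.sinh (2 * s)) (Ioc 0 t) :=
    IntegrableOn.congr_fun ((hB t).const_mul (-χ t)) h1.symm measurableSet_Ioc
  have hI2 : IntegrableOn (fun s => greenKernel φ χ t s * g s * Real.sinh (2 * s)) (Ioi t) :=
    IntegrableOn.congr_fun ((hA.mono_set (Set.Ioi_subset_Ioi ht.le)).const_mul (-φ t)) h2.symm measurableSet_Ioi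
  rw [← hsplit, setIntegral_union hdisj measurableSet_Ioi hI1 hI2,
    setIntegral_congr_fun measurableSet_Ioc h1, setIntegral_congr_fun measurableSet_Ioi h2,
    MeasureTheory.integral_const_mul, MeasureTheory.integral_const_mul]
  unfold greenSolI greenBI greenAI
  ring

/-- A function continuous on `(0, ∞)` and vanishing off `[a, b]` (`0 < a`) is integrable on `(0, ∞)`. -/
theorem integrableOn_Ioi_of_support {F : ℝ → ℝ} (hF : ContinuousOn F (Ioi 0)) {a b : ℝ} (ha : 0 < a)
    (hFa : ∀ s, s ≤ a → F s = 0) (hFb : ∀ s, b ≤ s → F s = 0) : IntegrableOn F (Ioi 0) := by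
  have hsub : Ioi 0 ⊆ Ioc 0 a ∪ Icc a b ∪ Ioi b := by
    intro s hs
    rcases le_or_gt s a with h1 | h1
    · exact Or.inl (Or.inl ⟨hs, h1⟩)
    · rcases le_or_gt s b with h2 | h2
      · exact Or.inl (Or.inr ⟨h1.le, h2⟩)
      · exact Or.inr h2
  have hI1 : IntegrableOn F (Ioc 0 a) :=
    integrableOn_zero.congr_fun (fun s hs => (hFa s hs.2).symm) measurableSet_Ioc
  have hI2 : IntegrableOn F (Icc a b) :=
    (hF.mono (fun s hs => lt_of_lt_of_le ha hs.1)).integrableOn_Icc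
  have hI3 : IntegrableOn F (Ioi b) :=
    integrableOn_zero.congr_fun (fun s hs => (hFb s (le_of_lt hs)).symm) measurableSet_Ioi
  exact ((hI1.union hI2).union hI3).mono_set hsub

section measure

variable [MeasurableSpace Circle] [BorelSpace Circle]

variable {lam a b : ℝ} {f : ℝ → ℝ} (hlam : 1 < lam) (hf : ContinuousOn f (Ioi 0)) (ha : 0 < a) (hab : a ≤ b)
  (hfa : ∀ s, s ≤ a → f s = 0) (hfb : ∀ s, b ≤ s → f s = 0)

include hf ha hfa hfb in
/-- `φ_λ f sinh 2s` is integrable on every `(0, T]` for a source supported in `[a, b]`. -/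
theorem integrableOn_sph_mul_Ioc_of_support (T : ℝ) :
    IntegrableOn (fun s => sph lam (hyp s) * f s * Real.sinh (2 * s)) (Ioc 0 T) :=
  (integrableOn_Ioi_of_support (continuousOn_greenB_integrand (hφ_sph lam) hf) ha
    (fun s hs => by rw [hfa s hs]; ring) (fun s hs => by rw [hfb s hs]; ring)).mono_set Set.Ioc_subset_Ioi_self

include hlam hf ha hfa hfb in
/-- `χ_λ f sinh 2s` is integrable on `(0, ∞)` for a source supported in `[a, b]`. -/
theorem integrableOn_sphDecay_mul_Ioi_of_support :
    IntegrableOn (fun s => sphDecay lam s * f s * Real.sinh (2 * s)) (Ioi 0) :=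
  integrableOn_Ioi_of_support (continuousOn_greenB_integrand (fun _ ht => hasDerivAt_sphDecay hlam ht) hf) ha
    (fun s hs => by rw [hfa s hs]; ring) (fun s hs => by rw [hfb s hs]; ring)

include hlam hf ha hab hfa hfb in
/-- **`G_λ f(t) = ∫_a^b K_λ(t, s) f(s) sinh 2s ds` for EVERY `t > 0`** when `f` is supported in `[a, b]`. -/
theorem sphGreen_eq_integral_kernel_all {t : ℝ} (ht : 0 < t) :
    sphGreen lam f a b t = ∫ s in a..b, sphGreenKernel lam t s * f s * Real.sinh (2 * s) := by
  have h1 : sphGreen lam f a b t = greenSolI (fun t => sph lam (hyp t)) (sphDecay lam) f t :=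
    (greenSolI_eq_greenSol (hφ_sph lam) (fun _ hs => hasDerivAt_sphDecay hlam hs) hf ha hab hfa hfb ht).symm
  rw [h1, greenSolI_eq_integral_kernel (integrableOn_sph_mul_Ioc_of_support hf ha hfa hfb)
    (integrableOn_sphDecay_mul_Ioi_of_support hlam hf ha hfa hfb) ht, integral_of_le hab]
  unfold sphGreenKernel
  apply setIntegral_eq_of_subset_of_forall_sdiff_eq_zero measurableSet_Ioi (fun s hs => lt_trans ha hs.1)
  intro s hs
  rcases le_or_gt s a with h | h
  · rw [hfa s h]; ring
  · rcases le_or_gt s b with h2 | h2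
    · exact absurd ⟨h, h2⟩ hs.2
    · rw [hfb s h2.le]; ring

include hlam in
/-- `s ↦ K_λ(t, s)` is continuous on `(0, ∞)` for `t > 0`. -/
theorem continuousOn_sphGreenKernel {t : ℝ} (ht : 0 < t) :
    ContinuousOn (fun s => sphGreenKernel lam t s) (Ioi 0) := by
  have hχ : ContinuousOn (sphDecay lam) (Ioi 0) :=
    fun _ hs => (hasDerivAt_sphDecay hlam hs).continuousAt.continuousWithinAt
  unfold sphGreenKernel greenKernel
  apply ContinuousOn.neg
  apply ContinuousOn.mul
  · exact (continuous_sph_hyp lam).comp_continuousOn (continuous_const.min continuous_id).continuousOn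
  · exact hχ.comp (continuous_const.max continuous_id).continuousOn
      (fun s _ => lt_of_lt_of_le ht (le_max_left t s))

include hlam hf ha hab in
/-- `s ↦ K_λ(t, s) f(s) sinh 2s` is interval integrable on `[a, b]`. -/
theorem intervalIntegrable_sphGreenKernel_mul {t : ℝ} (ht : 0 < t) :
    IntervalIntegrable (fun s => sphGreenKernel lam t s * f s * Real.sinh (2 * s)) volume a b := by
  have hb : 0 < b := lt_of_lt_of_le ha hab
  have hc : ContinuousOn (fun s => sphGreenKernel lam t s * f s * Real.sinh (2 * s)) (Ioi 0) :=
    ((continuousOn_sphGreenKernel hlam ht).mul hf).mul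
      (Real.continuous_sinh.comp (continuous_const.mul continuous_id)).continuousOn
  exact (hc.mono (uIcc_subset_Ioi ha hb)).intervalIntegrable

include hlam hf ha hab hfa hfb in
/-- **THE KERNEL OF THE COMPOSITION IS THE DIFFERENCE QUOTIENT OF THE KERNELS**: for `λ ≠ λ₂` (both `> 1`) and
`f` supported in `[a, b]`, `G^I_λ(G_{λ₂} f)(t) = ∫_a^b (K_λ(t, s) − K_{λ₂}(t, s))/(μ − μ₂) · f(s) sinh 2s ds`
for every `t > 0`. -/
theorem sphGreen_comp_eq_integral_kernel {lam₂ : ℝ} (hlam₂ : 1 < lam₂) (hne : lam ≠ lam₂) {t : ℝ} (ht : 0 < t) :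
    greenSolI (fun t => sph lam (hyp t)) (sphDecay lam) (sphGreen lam₂ f a b) t
      = ∫ s in a..b, (sphGreenKernel lam t s - sphGreenKernel lam₂ t s) / (lam * (lam - 2) - lam₂ * (lam₂ - 2))
          * f s * Real.sinh (2 * s) := by
  have hκ : lam * (lam - 2) - lam₂ * (lam₂ - 2) ≠ 0 := (mu_sub_ne_zero hlam hlam₂).mpr hne
  have hcomp := sphGreen_sub_sphGreen_eq hlam hlam₂ hf ha hab hfa hfb ht
  have hG : greenSolI (fun t => sph lam (hyp t)) (sphDecay lam) (sphGreen lam₂ f a b) t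
      = (sphGreen lam f a b t - sphGreen lam₂ f a b t) / (lam * (lam - 2) - lam₂ * (lam₂ - 2)) := by
    rw [eq_div_iff hκ, mul_comm]
    exact hcomp.symm
  rw [hG, sphGreen_eq_integral_kernel_all hlam hf ha hab hfa hfb ht,
    sphGreen_eq_integral_kernel_all hlam₂ hf ha hab hfa hfb ht,
    ← integral_sub (intervalIntegrable_sphGreenKernel_mul hlam hf ha hab ht)
      (intervalIntegrable_sphGreenKernel_mul hlam₂ hf ha hab ht), ← intervalIntegral.integral_div]
  apply integral_congr
  intro s _
  simp only
  ring

end measure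

end Summit.Ventures.HodgeRepro2.T5SU11ResolventKernelComposition
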